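import Mathlib

/-!
# Crux `MonotoneSuffices` (stmt-PneNP-18026), line `Sketch` — density-shift rung, stub `stub_diagonal`

The generic DIAGONAL ARGUMENT (rung W4 of the density-shift ladder). For each tolerance `1/(j+1)`
the finite shift lemma yields a family `M j : (n : ℕ) → X n` (think: `X n` = circuits at size `n`,
`P n` = "monotone and small", `err n` = error sum in `ℝ≥0∞`) that is EVENTUALLY good with error
`≤ 1/(j+1)`. This file extracts ONE family that is eventually good and whose error tends to `0`:

* take thresholds `N j` past which `M j` is good, make them monotone (`T j = sup_{i ≤ j} N i`),
* at size `n` use the largest index `j ≤ n` whose threshold is already passed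
  (`idx n = Nat.findGreatest (T · ≤ n) n`), and set `M n := M (idx n) n`;
* `idx n → ∞`, so the error `≤ 1/(idx n + 1)` is squeezed to `0`.

Pure Mathlib analysis (`Filter.eventually_atTop`, `Nat.findGreatest`, the squeeze theorem).
-/

set_option linter.dupNamespace false -- `Summit.PneNP.PneNP.…`: summit = sub-problem name (D-0017)

namespace Summit.PneNP.PneNP.Theorems.MonotoneSuffices.DensityShift

open Filter
open scoped ENNReal

/-- `1/(j+1) → 0` in `ℝ≥0∞` along `j → ∞`. [folklore] -/
theorem diagonal_tendsto_inv_natCast_add_one :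
    Tendsto (fun j : ℕ => ((j : ℝ≥0∞) + 1)⁻¹) atTop (nhds 0) := by
  have h := ENNReal.tendsto_inv_nat_nhds_zero.comp (tendsto_add_atTop_nat 1)
  refine h.congr fun j => ?_
  simp only [Function.comp_apply, Nat.cast_add, Nat.cast_one]

/-- **Monotone thresholds.** Any sequence of thresholds `N : ℕ → ℕ` is dominated by a monotone one.
[folklore] -/
theorem diagonal_exists_monotone_ge (N : ℕ → ℕ) : ∃ T : ℕ → ℕ, Monotone T ∧ ∀ j, N j ≤ T j :=
  ⟨fun j => (Finset.range (j + 1)).sup N,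
    fun _ _ hab => Finset.sup_mono (Finset.range_mono (Nat.succ_le_succ hab)),
    fun j => Finset.le_sup (f := N) (Finset.self_mem_range_succ j)⟩

/-- **Diagonal index.** For thresholds `T : ℕ → ℕ` there is an index choice `idx : ℕ → ℕ` with
`T (idx n) ≤ n` as soon as `T 0 ≤ n`, and `J ≤ idx n` as soon as `T J ≤ n` and `J ≤ n`
(namely `idx n = Nat.findGreatest (T · ≤ n) n`). [folklore] -/
theorem diagonal_exists_index (T : ℕ → ℕ) :
    ∃ idx : ℕ → ℕ, (∀ n, T 0 ≤ n → T (idx n) ≤ n) ∧ ∀ J n, T J ≤ n → J ≤ n → J ≤ idx n :=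
  ⟨fun n => Nat.findGreatest (fun j => T j ≤ n) n,
    fun n hn => Nat.findGreatest_spec (P := fun j => T j ≤ n) (Nat.zero_le n) hn,
    fun _ n hJ hJn => Nat.le_findGreatest (P := fun j => T j ≤ n) hJn hJ⟩

/-- **Diagonal extraction (rung W4).** If for every `j` some family `M : (n : ℕ) → X n` eventually
satisfies `P` with error `≤ 1/(j+1)`, then ONE family eventually satisfies `P` with error `→ 0`.
[folklore] -/
theorem stub_diagonal :
    ∀ {X : ℕ → Type*} (P : (n : ℕ) → X n → Prop) (err : (n : ℕ) → X n → ℝ≥0∞),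
      (∀ j : ℕ, ∃ M : (n : ℕ) → X n, ∀ᶠ n : ℕ in atTop, P n (M n) ∧ err n (M n) ≤ ((j : ℝ≥0∞) + 1)⁻¹) →
      ∃ M : (n : ℕ) → X n,
        (∀ᶠ n : ℕ in atTop, P n (M n)) ∧ Tendsto (fun n => err n (M n)) atTop (nhds 0) := by
  intro X P err h
  choose M hM using h
  have hN : ∀ j, ∃ N : ℕ, ∀ n ≥ N, P n (M j n) ∧ err n (M j n) ≤ ((j : ℝ≥0∞) + 1)⁻¹ := fun j =>
    eventually_atTop.1 (hM j)
  choose N hN using hN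
  obtain ⟨T, hTmono, hNT⟩ := diagonal_exists_monotone_ge N
  obtain ⟨idx, hidx, hle⟩ := diagonal_exists_index T
  -- past `T 0`, the diagonal family is good with error `≤ 1/(idx n + 1)`
  have hgood : ∀ n, T 0 ≤ n →
      P n (M (idx n) n) ∧ err n (M (idx n) n) ≤ ((idx n : ℝ≥0∞) + 1)⁻¹ := fun n hn =>
    hN (idx n) n ((hNT _).trans (hidx n hn))
  -- the index tends to infinity
  have hidx_top : Tendsto idx atTop atTop := by
    refine tendsto_atTop.2 fun J => ?_
    filter_upwards [eventually_ge_atTop (max (T J) J)] with n hn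
    exact hle J n ((le_max_left _ _).trans hn) ((le_max_right _ _).trans hn)
  refine ⟨fun n => M (idx n) n, ?_, ?_⟩
  · filter_upwards [eventually_ge_atTop (T 0)] with n hn
    exact (hgood n hn).1
  · refine tendsto_of_tendsto_of_tendsto_of_le_of_le' tendsto_const_nhds
      (diagonal_tendsto_inv_natCast_add_one.comp hidx_top) (Eventually.of_forall fun _ => zero_le) ?_
    filter_upwards [eventually_ge_atTop (T 0)] with n hn
    exact (hgood n hn).2

end Summit.PneNP.PneNP.Theorems.MonotoneSuffices.DensityShift
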